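import Summits.AtomisticToContinuum.Crystallization.Theorems.SlackRigidity.Negative.WitnessBasics
import Summits.AtomisticToContinuum.Crystallization.Theorems.ThreeConeCertificateSlackRigidityRodDefs
import Literature.MathematicalPhysics.StatisticalMechanics.BarlowStacking
import Mathlib.Analysis.Fourier.FourierTransform
import Mathlib.Analysis.SpecialFunctions.JapaneseBracket
import Mathlib.Analysis.PSeries
import HarnessLib

/-!
# Torus-section unfolding of a silent Barlow stacking — part A: section geometry and decay
(line `signed-root-silent-field` of crux `SlackRigidity`, stmt-AtomisticToContinuum-11960,
helper file of the registered stub `stub_layerUnfolding`; no definitions are introduced — the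
character `χ(u) = e^{−2πi⟨u, G⟩}`, the section kernels `g_c(x) = K(√(|x|² + c²))`, the planar lattice
vectors `λ_n = (a(n₁ + n₂/2), (a√3/2) n₂)` and the letter offsets `c_k = (a L_k/2, (a√3/2)(L_k/3))`
(`L_k = haggLabel s k`) enter the lemmas as functions constrained by defining equations)

We parametrise the Barlow stacking `barlowStacking a h s` by `ℤ × (ℤ × ℤ)` (layer index `k`,
in-layer index `n = (i, j)`), write the distance from a point `(u, t)` of the section `x₃ = t` to the
stacking point `(k, n)` as `√(|u − (λ_n + c_k)|² + (t − kh)²)`, compute the class-1 character on the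
layer lattice (`⟨λ_n, G⟩ = n₁ ∈ ℤ`, `⟨c_k, G⟩ = L_k/3`, `G = rodDual a`), and record the decay split
`|K(√(A² + c²))| ≤ C_K (1+A)^{-5/2} (1+|c|)^{-3/2}` with its two consequences: the section kernels
have `∫ |g_c| ≤ (1+|c|)^{-3/2} · ∫ C_K (1+|x|)^{-5/2} dx < ∞` and `Σ_k (1+|t−kh|)^{-3/2} < ∞`, so
`Σ_k ∫ |g_{t−kh}| < ∞`.  All `[folklore]`.
-/

noncomputable section

open scoped BigOperators Topology FourierTransform ENNReal
open MeasureTheory Filter Set Metric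
open Literature.MathematicalPhysics.StatisticalMechanics
open Summit.AtomisticToContinuum.Crystallization.Theorems.SlackRigidityNegative (E3)
open Summit.AtomisticToContinuum.Crystallization.Theorems.SignedRootSilentField
  (E2 rodDual rodPoint rodProfile rodPhase rodProfile_def rodPhase_def)

namespace Summit.AtomisticToContinuum.Crystallization.Theorems.SignedRootUnfolding

/-! ### Section coordinates and the parametrisation of the stacking -/

/-- `|x|² = x₀² + x₁²` in the plane. [folklore] -/
theorem norm_sq_eq_E2 (x : E2) : ‖x‖ ^ 2 = x 0 ^ 2 + x 1 ^ 2 := by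
  rw [EuclideanSpace.norm_eq, Real.sq_sqrt (Finset.sum_nonneg fun i _ => sq_nonneg _),
    Fin.sum_univ_two]
  simp only [Real.norm_eq_abs, sq_abs]

/-- **Section coordinates**: the distance from the section point `(u, t)` to the stacking point
`(k, n)` is `√(|u − (λ_n + c_k)|² + (t − kh)²)`, where `λ_n + c_k` is the planar position of that
point (`barlowPos_apply_zero/one/two`). [folklore] -/
theorem norm_sec_sub_barlowPos (a h t : ℝ) (s : ℤ → ℤ) {lat : ℤ × ℤ → E2} {off : ℤ → E2}
    (hlat : ∀ n : ℤ × ℤ, lat n = !₂[a * (n.1 + n.2 / 2), a * Real.sqrt 3 / 2 * n.2])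
    (hoff : ∀ k : ℤ, off k = !₂[a * (haggLabel s k / 2), a * Real.sqrt 3 / 2 * (haggLabel s k / 3)])
    (u : E2) (k : ℤ) (n : ℤ × ℤ) :
    ‖(!₂[u 0, u 1, t] : E3) - barlowPos a h s k n.1 n.2‖ =
      Real.sqrt (‖u - (lat n + off k)‖ ^ 2 + (t - k * h) ^ 2) := by
  rw [EuclideanSpace.norm_eq, Fin.sum_univ_three, norm_sq_eq_E2, hlat, hoff]
  congr 1
  simp [Real.norm_eq_abs, sq_abs, barlowPos_apply_zero, barlowPos_apply_one, barlowPos_apply_two]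
  ring

/-- **The Barlow stacking is parametrised bijectively by `ℤ × (ℤ × ℤ)`** (`a, h > 0`):
`(k, (i, j)) ↦ barlowPos a h s k i j` (distinct triples give points at distance `≥ min a h`,
`le_dist_barlowPos`). [folklore] -/
theorem exists_stackingEquiv {a h : ℝ} (ha : 0 < a) (hh : 0 < h) (s : ℤ → ℤ) :
    ∃ e : ℤ × (ℤ × ℤ) ≃ ↥(barlowStacking a h s),
      ∀ m : ℤ × (ℤ × ℤ), ((e m : ↥(barlowStacking a h s)) : E3) = barlowPos a h s m.1 m.2.1 m.2.2 := by
  refine ⟨Equiv.ofBijective (fun m => ⟨barlowPos a h s m.1 m.2.1 m.2.2, barlowPos_mem _ _ _⟩)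
    ⟨fun m m' hmm' => ?_, fun ⟨x, hx⟩ => ?_⟩, fun m => rfl⟩
  · by_contra hne
    have hd := le_dist_barlowPos a h s ha.le hh.le (k := m.1) (i := m.2.1) (j := m.2.2)
      (k' := m'.1) (i' := m'.2.1) (j' := m'.2.2) (by simpa [Prod.ext_iff] using hne)
    have h0 : dist (barlowPos a h s m.1 m.2.1 m.2.2) (barlowPos a h s m'.1 m'.2.1 m'.2.2) = 0 := by
      rw [dist_eq_zero]
      exact congrArg Subtype.val hmm'
    have := lt_min ha hh
    linarith
  · obtain ⟨k, i, j, rfl⟩ := hx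
    exact ⟨(k, i, j), rfl⟩

/-- **Silence read on a section**: if the stacking is silent for `K`, then for every `t` and
`u ∈ ℝ²`, `Σ_{k,n} K(√(|u − (λ_n + c_k)|² + (t − kh)²)) = 0`. [folklore] -/
theorem hasSum_section {a h : ℝ} (ha : 0 < a) (hh : 0 < h) {K : ℝ → ℝ} {s : ℤ → ℤ}
    {lat : ℤ × ℤ → E2} {off : ℤ → E2}
    (hlat : ∀ n : ℤ × ℤ, lat n = !₂[a * (n.1 + n.2 / 2), a * Real.sqrt 3 / 2 * n.2])
    (hoff : ∀ k : ℤ, off k = !₂[a * (haggLabel s k / 2), a * Real.sqrt 3 / 2 * (haggLabel s k / 3)])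
    (hsil : ∀ y : E3, HasSum (fun q : ↥(barlowStacking a h s) => K ‖y - (q : E3)‖) 0)
    (t : ℝ) (u : E2) :
    HasSum (fun m : ℤ × (ℤ × ℤ) =>
      K (Real.sqrt (‖u - (lat m.2 + off m.1)‖ ^ 2 + (t - m.1 * h) ^ 2))) 0 := by
  obtain ⟨e, he⟩ := exists_stackingEquiv ha hh s
  have := (e.hasSum_iff).mpr (hsil (!₂[u 0, u 1, t]))
  convert this using 1
  funext m
  simp only [Function.comp_apply, he, norm_sec_sub_barlowPos a h t s hlat hoff]

/-! ### The class-1 character on the layer lattice -/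

/-- `⟨u, G⟩ = u₀/a − u₁/(a√3)`. [folklore] -/
theorem inner_rodDual (a : ℝ) (u : E2) :
    inner ℝ u (rodDual a) = u 0 * (1 / a) + u 1 * (-1 / (a * Real.sqrt 3)) := by
  rw [PiLp.inner_apply, Fin.sum_univ_two]
  simp only [SignedRootSilentField.rodDual_apply_zero, SignedRootSilentField.rodDual_apply_one]
  simp
  ring

/-- `⟨λ_n, G⟩ = n₁` — the dual vector is integral on the layer lattice. [folklore] -/
theorem inner_lat_rodDual {a : ℝ} (ha : a ≠ 0) (n : ℤ × ℤ) :
    inner ℝ (!₂[a * (n.1 + n.2 / 2), a * Real.sqrt 3 / 2 * n.2] : E2) (rodDual a) = n.1 := by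
  rw [inner_rodDual]
  have h3 : Real.sqrt 3 ≠ 0 := by positivity
  simp
  field_simp
  ring

/-- `⟨c_k, G⟩ = L/3` — the letter offset of label `L` has class `L/3`. [folklore] -/
theorem inner_off_rodDual {a : ℝ} (ha : a ≠ 0) (L : ℝ) :
    inner ℝ (!₂[a * (L / 2), a * Real.sqrt 3 / 2 * (L / 3)] : E2) (rodDual a) = L / 3 := by
  rw [inner_rodDual]
  have h3 : Real.sqrt 3 ≠ 0 := by positivity
  simp
  field_simp
  ring

/-- **`χ` is periodic under the layer lattice**: `χ(u − λ_n) = χ(u)`. [folklore] -/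
theorem chi_sub_lat {a : ℝ} (ha : a ≠ 0) {χ : E2 → ℂ} {lat : ℤ × ℤ → E2}
    (hχ : ∀ u : E2, χ u = Complex.exp (↑(-2 * Real.pi * inner ℝ u (rodDual a)) * Complex.I))
    (hlat : ∀ n : ℤ × ℤ, lat n = !₂[a * (n.1 + n.2 / 2), a * Real.sqrt 3 / 2 * n.2])
    (u : E2) (n : ℤ × ℤ) : χ (u - lat n) = χ u := by
  rw [hχ, hχ, hlat, inner_sub_left, inner_lat_rodDual ha]
  have : (↑(-2 * Real.pi * (inner ℝ u (rodDual a) - (n.1 : ℝ))) : ℂ) * Complex.I =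
      ↑(-2 * Real.pi * inner ℝ u (rodDual a)) * Complex.I + (n.1 : ℂ) * (2 * Real.pi * Complex.I) := by
    push_cast
    ring
  rw [this, Complex.exp_add, Complex.exp_int_mul_two_pi_mul_I, mul_one]

/-- **The letter offset produces the layer phase**: `χ(u + c_k) = ω^{L_k} χ(u)`. [folklore] -/
theorem chi_add_off {a : ℝ} (ha : a ≠ 0) (s : ℤ → ℤ) {χ : E2 → ℂ} {off : ℤ → E2}
    (hχ : ∀ u : E2, χ u = Complex.exp (↑(-2 * Real.pi * inner ℝ u (rodDual a)) * Complex.I))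
    (hoff : ∀ k : ℤ, off k = !₂[a * (haggLabel s k / 2), a * Real.sqrt 3 / 2 * (haggLabel s k / 3)])
    (k : ℤ) (u : E2) : χ (u + off k) = rodPhase s k * χ u := by
  rw [hχ, hχ, hoff, inner_add_left, inner_off_rodDual ha, rodPhase_def, ← Complex.exp_add]
  congr 1
  push_cast
  ring

/-- `χ` is unimodular (extended norm). [folklore] -/
theorem enorm_chi {a : ℝ} {χ : E2 → ℂ}
    (hχ : ∀ u : E2, χ u = Complex.exp (↑(-2 * Real.pi * inner ℝ u (rodDual a)) * Complex.I))
    (u : E2) : ‖χ u‖ₑ = 1 := by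
  rw [← ofReal_norm, hχ, Complex.norm_exp_ofReal_mul_I, ENNReal.ofReal_one]

/-- `χ` is continuous. [folklore] -/
theorem continuous_chi {a : ℝ} {χ : E2 → ℂ}
    (hχ : ∀ u : E2, χ u = Complex.exp (↑(-2 * Real.pi * inner ℝ u (rodDual a)) * Complex.I)) :
    Continuous χ := by
  rw [show χ = fun u => Complex.exp (↑(-2 * Real.pi * inner ℝ u (rodDual a)) * Complex.I) from
    funext hχ]
  fun_prop

/-! ### The section kernels and the decay split -/

/-- The section kernels `g_c(x) = K(√(|x|² + c²))` are continuous for continuous `K`. [folklore] -/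
theorem continuous_sectionKernel {K : ℝ → ℝ} (hK : Continuous K) {g : ℝ → E2 → ℂ}
    (hg : ∀ (c : ℝ) (x : E2), g c x = ((K (Real.sqrt (‖x‖ ^ 2 + c ^ 2)) : ℝ) : ℂ)) (c : ℝ) :
    Continuous (g c) := by
  rw [show g c = fun x => ((K (Real.sqrt (‖x‖ ^ 2 + c ^ 2)) : ℝ) : ℂ) from funext (hg c)]
  fun_prop

/-- **Decay split**: `|K(√(A² + c²))| ≤ C_K (1+A)^{-5/2} (1+|c|)^{-3/2}` for `A ≥ 0`, from
`|K(r)| ≤ C_K (1+r)⁻⁴` and `1 + √(A²+c²) ≥ max(1+A, 1+|c|)`. [folklore] -/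
theorem decay_split {CK : ℝ} {K : ℝ → ℝ} (hK : ∀ r : ℝ, 0 ≤ r → |K r| ≤ CK / (1 + r) ^ 4)
    {A : ℝ} (hA : 0 ≤ A) (c : ℝ) :
    |K (Real.sqrt (A ^ 2 + c ^ 2))| ≤
      CK * (1 + A) ^ (-(5 / 2 : ℝ)) * (1 + |c|) ^ (-(3 / 2 : ℝ)) := by
  have hCK : 0 ≤ CK := by
    have h0 := hK 0 le_rfl
    simp only [add_zero, one_pow, div_one] at h0
    exact (abs_nonneg _).trans h0
  set R := Real.sqrt (A ^ 2 + c ^ 2) with hR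
  have hR0 : 0 ≤ R := Real.sqrt_nonneg _
  have hAR : A ≤ R := by
    have := Real.abs_le_sqrt (show A ^ 2 ≤ A ^ 2 + c ^ 2 by nlinarith)
    rwa [abs_of_nonneg hA] at this
  have hcR : |c| ≤ R := Real.abs_le_sqrt (by nlinarith)
  have h1 : 0 < 1 + A := by linarith
  have h2 : 0 < 1 + |c| := by positivity
  have h3 : 0 < 1 + R := by linarith
  calc |K R| ≤ CK / (1 + R) ^ 4 := hK R hR0
    _ = CK * ((1 + R) ^ (5 / 2 : ℝ) * (1 + R) ^ (3 / 2 : ℝ))⁻¹ := by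
        rw [← Real.rpow_add h3, div_eq_mul_inv]
        norm_num
    _ ≤ CK * ((1 + A) ^ (5 / 2 : ℝ) * (1 + |c|) ^ (3 / 2 : ℝ))⁻¹ := by
        refine mul_le_mul_of_nonneg_left (inv_anti₀ (by positivity) ?_) hCK
        exact mul_le_mul (Real.rpow_le_rpow h1.le (by linarith) (by norm_num))
          (Real.rpow_le_rpow h2.le (by linarith) (by norm_num)) (by positivity) (by positivity)
    _ = CK * (1 + A) ^ (-(5 / 2 : ℝ)) * (1 + |c|) ^ (-(3 / 2 : ℝ)) := by
        rw [Real.rpow_neg h1.le, Real.rpow_neg h2.le, mul_inv, mul_assoc]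

/-- Pointwise bound for the section kernels. [folklore] -/
theorem norm_sectionKernel_le {CK : ℝ} {K : ℝ → ℝ}
    (hK : ∀ r : ℝ, 0 ≤ r → |K r| ≤ CK / (1 + r) ^ 4) {g : ℝ → E2 → ℂ}
    (hg : ∀ (c : ℝ) (x : E2), g c x = ((K (Real.sqrt (‖x‖ ^ 2 + c ^ 2)) : ℝ) : ℂ)) (c : ℝ) (x : E2) :
    ‖g c x‖ ≤ CK * (1 + ‖x‖) ^ (-(5 / 2 : ℝ)) * (1 + |c|) ^ (-(3 / 2 : ℝ)) := by
  rw [hg, Complex.norm_real, Real.norm_eq_abs]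
  exact decay_split hK (norm_nonneg x) c

/-- The planar majorant `C_K (1+|x|)^{-5/2}` is integrable on `ℝ²` (`2 < 5/2`). [folklore] -/
theorem integrable_majorant (CK : ℝ) :
    Integrable (fun x : E2 => CK * (1 + ‖x‖) ^ (-(5 / 2 : ℝ))) := by
  refine (integrable_one_add_norm ?_).const_mul CK
  simp only [finrank_euclideanSpace_fin, Nat.cast_ofNat]
  norm_num

/-- The section kernels are integrable on `ℝ²`. [folklore] -/
theorem integrable_sectionKernel {CK : ℝ} {K : ℝ → ℝ} (hKc : Continuous K)
    (hK : ∀ r : ℝ, 0 ≤ r → |K r| ≤ CK / (1 + r) ^ 4) {g : ℝ → E2 → ℂ}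
    (hg : ∀ (c : ℝ) (x : E2), g c x = ((K (Real.sqrt (‖x‖ ^ 2 + c ^ 2)) : ℝ) : ℂ)) (c : ℝ) :
    Integrable (g c) := by
  refine (integrable_majorant (CK * (1 + |c|) ^ (-(3 / 2 : ℝ)))).mono'
    (continuous_sectionKernel hKc hg c).aestronglyMeasurable (Eventually.of_forall fun x => ?_)
  calc ‖g c x‖ ≤ CK * (1 + ‖x‖) ^ (-(5 / 2 : ℝ)) * (1 + |c|) ^ (-(3 / 2 : ℝ)) :=
        norm_sectionKernel_le hK hg c x
    _ = CK * (1 + |c|) ^ (-(3 / 2 : ℝ)) * (1 + ‖x‖) ^ (-(5 / 2 : ℝ)) := by ring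

/-- The planar majorant has finite Lebesgue integral. [folklore] -/
theorem lintegral_majorant_lt_top (CK : ℝ) :
    ∫⁻ x : E2, ENNReal.ofReal (CK * (1 + ‖x‖) ^ (-(5 / 2 : ℝ))) < ∞ :=
  (integrable_majorant CK).lintegral_lt_top

/-- **Layer-wise `L¹` bound**: `∫ |g_c| ≤ (1+|c|)^{-3/2} · ∫ C_K (1+|x|)^{-5/2} dx`. [folklore] -/
theorem lintegral_enorm_sectionKernel_le {CK : ℝ} {K : ℝ → ℝ}
    (hK : ∀ r : ℝ, 0 ≤ r → |K r| ≤ CK / (1 + r) ^ 4) {g : ℝ → E2 → ℂ}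
    (hg : ∀ (c : ℝ) (x : E2), g c x = ((K (Real.sqrt (‖x‖ ^ 2 + c ^ 2)) : ℝ) : ℂ)) (c : ℝ) :
    ∫⁻ x : E2, ‖g c x‖ₑ ≤ ENNReal.ofReal ((1 + |c|) ^ (-(3 / 2 : ℝ))) *
      ∫⁻ x : E2, ENNReal.ofReal (CK * (1 + ‖x‖) ^ (-(5 / 2 : ℝ))) := by
  rw [← lintegral_const_mul' _ _ ENNReal.ofReal_ne_top]
  refine lintegral_mono fun x => ?_
  rw [← ofReal_norm, ← ENNReal.ofReal_mul (by positivity)]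
  refine ENNReal.ofReal_le_ofReal ?_
  calc ‖g c x‖ ≤ CK * (1 + ‖x‖) ^ (-(5 / 2 : ℝ)) * (1 + |c|) ^ (-(3 / 2 : ℝ)) :=
        norm_sectionKernel_le hK hg c x
    _ = (1 + |c|) ^ (-(3 / 2 : ℝ)) * (CK * (1 + ‖x‖) ^ (-(5 / 2 : ℝ))) := by ring

/-! ### Summability over the layers -/

/-- `Σ_{k ∈ ℤ} (1 + |k|)^{-3/2} < ∞`. [folklore] -/
theorem summable_one_add_abs_int_rpow : Summable fun k : ℤ => (1 + |(k : ℝ)|) ^ (-(3 / 2 : ℝ)) := by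
  have hnat : Summable fun n : ℕ => ((n : ℝ) + 1) ^ (-(3 / 2 : ℝ)) := by
    have := (summable_nat_add_iff (f := fun n : ℕ => (n : ℝ) ^ (-(3 / 2 : ℝ))) 1).mpr
      (Real.summable_nat_rpow.mpr (by norm_num))
    simpa using this
  refine Summable.of_nat_of_neg ?_ ?_
  · simpa [add_comm] using hnat
  · simpa [add_comm] using hnat

/-- **`Σ_k (1 + |t − kh|)^{-3/2} < ∞`** for `h > 0` (Peetre: `(1 + |t − kh|)(1 + |t|) ≥ 1 + |kh|`).
[folklore] -/
theorem summable_layers (t : ℝ) {h : ℝ} (hh : 0 < h) :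
    Summable fun k : ℤ => (1 + |t - k * h|) ^ (-(3 / 2 : ℝ)) := by
  set m₀ := min 1 h with hm₀def
  have hm₀ : 0 < m₀ := lt_min one_pos hh
  have ht : 0 < 1 + |t| := by positivity
  refine (summable_one_add_abs_int_rpow.mul_left ((m₀ / (1 + |t|)) ^ (-(3 / 2 : ℝ)))).of_nonneg_of_le
    (fun k => by positivity) fun k => ?_
  have key : m₀ / (1 + |t|) * (1 + |(k : ℝ)|) ≤ 1 + |t - k * h| := by
    rw [div_mul_eq_mul_div, div_le_iff₀ ht]
    have h1 : m₀ * (1 + |(k : ℝ)|) ≤ 1 + |(k : ℝ) * h| := by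
      rw [abs_mul, abs_of_pos hh]
      have := min_le_left 1 h
      have := min_le_right 1 h
      nlinarith [abs_nonneg (k : ℝ)]
    have h2 : 1 + |(k : ℝ) * h| ≤ (1 + |t - k * h|) * (1 + |t|) := by
      have := abs_sub_abs_le_abs_sub ((k : ℝ) * h) t
      rw [abs_sub_comm] at this
      nlinarith [abs_nonneg (t - k * h), abs_nonneg t]
    linarith
  calc (1 + |t - k * h|) ^ (-(3 / 2 : ℝ))
      ≤ (m₀ / (1 + |t|) * (1 + |(k : ℝ)|)) ^ (-(3 / 2 : ℝ)) :=
        Real.rpow_le_rpow_of_nonpos (by positivity) key (by norm_num)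
    _ = (m₀ / (1 + |t|)) ^ (-(3 / 2 : ℝ)) * (1 + |(k : ℝ)|) ^ (-(3 / 2 : ℝ)) :=
        Real.mul_rpow (by positivity) (by positivity)

/-- **Total `L¹` mass of the section kernels over all layers is finite**:
`Σ_k ∫ |g_{t−kh}| < ∞`. [folklore] -/
theorem tsum_lintegral_enorm_sectionKernel_lt_top {CK : ℝ} {K : ℝ → ℝ}
    (hK : ∀ r : ℝ, 0 ≤ r → |K r| ≤ CK / (1 + r) ^ 4) {g : ℝ → E2 → ℂ}
    (hg : ∀ (c : ℝ) (x : E2), g c x = ((K (Real.sqrt (‖x‖ ^ 2 + c ^ 2)) : ℝ) : ℂ))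
    (t : ℝ) {h : ℝ} (hh : 0 < h) :
    ∑' k : ℤ, ∫⁻ x : E2, ‖g (t - k * h) x‖ₑ < ∞ := by
  calc ∑' k : ℤ, ∫⁻ x : E2, ‖g (t - k * h) x‖ₑ
      ≤ ∑' k : ℤ, ENNReal.ofReal ((1 + |t - k * h|) ^ (-(3 / 2 : ℝ))) *
          ∫⁻ x : E2, ENNReal.ofReal (CK * (1 + ‖x‖) ^ (-(5 / 2 : ℝ))) :=
        ENNReal.tsum_le_tsum fun k => lintegral_enorm_sectionKernel_le hK hg _
    _ = (∑' k : ℤ, ENNReal.ofReal ((1 + |t - k * h|) ^ (-(3 / 2 : ℝ)))) *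
          ∫⁻ x : E2, ENNReal.ofReal (CK * (1 + ‖x‖) ^ (-(5 / 2 : ℝ))) :=
        ENNReal.tsum_mul_right
    _ < ∞ := by
        refine ENNReal.mul_lt_top ?_ (lintegral_majorant_lt_top CK)
        rw [← ENNReal.ofReal_tsum_of_nonneg (fun k => by positivity) (summable_layers t hh)]
        exact ENNReal.ofReal_lt_top

end Summit.AtomisticToContinuum.Crystallization.Theorems.SignedRootUnfolding

end
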